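import Mathlib
import Summits.Ventures.FusionMHD.Models.SolovevMercierAxisRegularAxisValue
import HarnessLib

/-!
# Axis-regular Mercier slope/intercept on the Lee–Cerfon / PCF Solov'ev family — §9: the divided-difference integrals
# `D₃, D₅` in INTEGRATION-BY-PARTS form `D₃ = −3R₀∫₀^{2π} sin²t·u^{−5/2}`, `D₅ = −5R₀∫₀^{π} sin²t·u^{−7/2}`

Sixth file of the `SolovevMercierAxisRegular*` set (gridfusion-model-7 (g4), LADDER-GRIDFUSION rung F1.MERCIER, 2026-08-27); the
bridge asked for by the kernel lane of #105 «F1.MERCIER-WHOLE-PROFILE-ITER» (gridfusion-sos-6, 2026-08-27T16:24Z: «D₃, D₅ are taken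
in integration-by-parts form … every kernel is then a product of (√u)⁻¹, u⁻¹, Q⁻¹, u and the rational trig registers»).
For every loop `0 ≤ r`, `2r < R₀` (axis included):
* `lcRegD3_eq_sinSq` — `lcRegD3 R₀ r = −3R₀·∫₀^{2π} sin²t·(u²√u)⁻¹ dt`;
* `lcRegD5_eq_sinSq` — `lcRegD5 R₀ r = −5R₀·∫₀^{π} sin²t·(u³√u)⁻¹ dt`.
Proof: for `r > 0`, `r·d₃ = (u√u)⁻¹ − R₀⁻³` (`mul_lcDivDiff3`) and integration by parts with `(sin t)′ = cos t`,
`d/dt (u√u)⁻¹ = 3rR₀ sin t·(u²√u)⁻¹` (`u′(t) = −2rR₀ sin t`), boundary terms `0`; likewise `r·d₅ = (u²√u)⁻¹ − R₀⁻⁵`,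
`d/dt (u²√u)⁻¹ = 5rR₀ sin t·(u³√u)⁻¹` on `[0, π]`; for `r = 0` both sides are `−3π/R₀⁴`, resp. `−5π/(2R₀⁶)`
(`lcRegD35_axis`, `∫sin²`).  So the kernel lane may enclose `∫sin²t·u^{−5/2}` and `∫₀^π sin²t·u^{−7/2}` (products of its
intrinsic registers) in place of the divided-difference kernels, with no change to `N₂, N₀`.
HONEST FRAMING: exact real analysis about MODEL objects; nothing here is an enclosure or a stability claim.
Sources: [bib `Jardin2010`] (8.134) inputs; loop of [bib `LeeCerfon2015`] §4.1.
-/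

noncomputable section

open Real Set MeasureTheory intervalIntegral Filter Topology
open Literature.MathematicalPhysics.MHD Literature.MathematicalPhysics.MHD.Solovev

namespace Summit.Ventures.FusionMHD.Models

namespace LcMercierRegular

section ibp

variable {R₀ r : ℝ} (hR₀ : 0 < R₀) (hr : 0 ≤ r) (h2r : 2 * r < R₀)

/-- `d/dt u = −2rR₀ sin t` along the loop. [cite: LeeCerfon2015, §4.1 (boundary parametrisation)] -/
theorem hasDerivAt_lcU_t (R₀ r t : ℝ) : HasDerivAt (fun t => lcU R₀ r t) (-(2 * r * R₀ * Real.sin t)) t := by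
  unfold lcU
  simpa using ((Real.hasDerivAt_cos t).const_mul (2 * r * R₀)).const_add (R₀ ^ 2)

include hR₀ hr h2r

/-- `d/dt (u√u)⁻¹ = 3rR₀ sin t·(u²√u)⁻¹`. [cite: LeeCerfon2015, §4.1 (boundary parametrisation)] -/
theorem hasDerivAt_inv_u_sqrt (t : ℝ) :
    HasDerivAt (fun t => (lcU R₀ r t * Real.sqrt (lcU R₀ r t))⁻¹)
      (3 * r * R₀ * Real.sin t * (lcU R₀ r t ^ 2 * Real.sqrt (lcU R₀ r t))⁻¹) t := by
  have hu := lcU_pos hR₀ hr h2r t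
  have hs : 0 < Real.sqrt (lcU R₀ r t) := Real.sqrt_pos.2 hu
  have hU := hasDerivAt_lcU_t R₀ r t
  have hS := hU.sqrt hu.ne'
  have hP := hU.mul hS
  have hI := hP.inv (mul_ne_zero hu.ne' hs.ne')
  refine hI.congr_deriv ?_
  simp only [Pi.mul_apply]
  set q := Real.sqrt (lcU R₀ r t) with hq_def
  have hss : q ^ 2 = lcU R₀ r t := Real.sq_sqrt hu.le
  have h2 : q ≠ 0 := hs.ne'
  rw [← hss]
  field_simp
  ring

/-- `d/dt (u²√u)⁻¹ = 5rR₀ sin t·(u³√u)⁻¹`. [cite: LeeCerfon2015, §4.1 (boundary parametrisation)] -/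
theorem hasDerivAt_inv_uSq_sqrt (t : ℝ) :
    HasDerivAt (fun t => (lcU R₀ r t ^ 2 * Real.sqrt (lcU R₀ r t))⁻¹)
      (5 * r * R₀ * Real.sin t * (lcU R₀ r t ^ 3 * Real.sqrt (lcU R₀ r t))⁻¹) t := by
  have hu := lcU_pos hR₀ hr h2r t
  have hs : 0 < Real.sqrt (lcU R₀ r t) := Real.sqrt_pos.2 hu
  have hU := hasDerivAt_lcU_t R₀ r t
  have hS := hU.sqrt hu.ne'
  have hP := (hU.fun_pow 2).mul hS
  have hI := hP.inv (mul_ne_zero (pow_ne_zero 2 hu.ne') hs.ne')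
  refine hI.congr_deriv ?_
  simp only [Pi.mul_apply]
  set q := Real.sqrt (lcU R₀ r t) with hq_def
  have hss : q ^ 2 = lcU R₀ r t := Real.sq_sqrt hu.le
  have h2 : q ≠ 0 := hs.ne'
  rw [← hss]
  norm_num
  field_simp
  ring

/-- **`D₃ = −3R₀∫₀^{2π} sin²t·(u²√u)⁻¹ dt`** on every loop `0 ≤ r`, `2r < R₀` (axis included).
[cite: Jardin2010, §8.5.4 eq. (8.134)] -/
theorem lcRegD3_eq_sinSq :
    lcRegD3 R₀ r = -3 * R₀ * ∫ t in (0 : ℝ)..(2 * π),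
      Real.sin t ^ 2 * (lcU R₀ r t ^ 2 * Real.sqrt (lcU R₀ r t))⁻¹ := by
  have hu := lcU_pos hR₀ hr h2r
  -- continuity of the target kernel
  have hcu : Continuous (fun t => lcU R₀ r t) := by unfold lcU; fun_prop
  have hne1 : ∀ t, lcU R₀ r t * Real.sqrt (lcU R₀ r t) ≠ 0 := fun t =>
    mul_ne_zero (hu t).ne' (Real.sqrt_pos.2 (hu t)).ne'
  have hne2 : ∀ t, lcU R₀ r t ^ 2 * Real.sqrt (lcU R₀ r t) ≠ 0 := fun t =>
    mul_ne_zero (pow_ne_zero 2 (hu t).ne') (Real.sqrt_pos.2 (hu t)).ne'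
  rcases hr.eq_or_lt with h0 | hpos
  · -- r = 0: both sides are −3π/R₀⁴
    subst h0
    rw [(lcRegD35_axis hR₀).1]
    have e : ∀ t ∈ uIcc (0 : ℝ) (2 * π),
        Real.sin t ^ 2 * (lcU R₀ 0 t ^ 2 * Real.sqrt (lcU R₀ 0 t))⁻¹ = (R₀ ^ 5)⁻¹ * Real.sin t ^ 2 := by
      intro t _; rw [sqrt_lcU_axis hR₀, lcU_axis]; ring
    rw [intervalIntegral.integral_congr e, intervalIntegral.integral_const_mul, integral_sin_sq]
    have hR := hR₀.ne'
    simp [Real.sin_two_pi]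
    field_simp
  · -- r > 0: divided difference + integration by parts
    have hU' : IntervalIntegrable (fun t => 3 * r * R₀ * Real.sin t * (lcU R₀ r t ^ 2 * Real.sqrt (lcU R₀ r t))⁻¹)
        volume 0 (2 * π) := by
      refine Continuous.intervalIntegrable ?_ _ _
      fun_prop (disch := assumption)
    have hparts := intervalIntegral.integral_mul_deriv_eq_deriv_mul (a := 0) (b := 2 * π)
      (u := fun t => (lcU R₀ r t * Real.sqrt (lcU R₀ r t))⁻¹) (v := Real.sin)
      (u' := fun t => 3 * r * R₀ * Real.sin t * (lcU R₀ r t ^ 2 * Real.sqrt (lcU R₀ r t))⁻¹) (v' := Real.cos)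
      (fun t _ => hasDerivAt_inv_u_sqrt hR₀ hr h2r t) (fun t _ => Real.hasDerivAt_sin t) hU'
      (Real.continuous_cos.intervalIntegrable _ _)
    -- r · D₃ = ∫ cos·(u√u)⁻¹ − R₀⁻³∫cos = ∫ (u√u)⁻¹ · cos
    have hc3 : Continuous fun t => Real.cos t * lcDivDiff3 R₀ r t :=
      (continuous_regKernels (κ := 1) one_ne_zero hR₀ hr h2r).2.2.2.2.2.2.2.1
    have hrD : r * lcRegD3 R₀ r = ∫ t in (0 : ℝ)..(2 * π), (lcU R₀ r t * Real.sqrt (lcU R₀ r t))⁻¹ * Real.cos t := by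
      unfold lcRegD3
      rw [← intervalIntegral.integral_const_mul]
      have e : ∀ t ∈ uIcc (0 : ℝ) (2 * π), r * (Real.cos t * lcDivDiff3 R₀ r t)
          = (lcU R₀ r t * Real.sqrt (lcU R₀ r t))⁻¹ * Real.cos t - (R₀ ^ 3)⁻¹ * Real.cos t := by
        intro t _
        have h := mul_lcDivDiff3 (r := r) (t := t) hR₀ (hu t)
        calc r * (Real.cos t * lcDivDiff3 R₀ r t) = Real.cos t * (r * lcDivDiff3 R₀ r t) := by ring
          _ = _ := by rw [h]; ring
      have hi1 : IntervalIntegrable (fun t => (lcU R₀ r t * Real.sqrt (lcU R₀ r t))⁻¹ * Real.cos t) volume 0 (2 * π) := by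
        refine Continuous.intervalIntegrable ?_ _ _
        fun_prop (disch := assumption)
      have hi2 : IntervalIntegrable (fun t => (R₀ ^ 3)⁻¹ * Real.cos t) volume 0 (2 * π) := by
        refine Continuous.intervalIntegrable ?_ _ _
        fun_prop
      rw [intervalIntegral.integral_congr e, intervalIntegral.integral_sub hi1 hi2, intervalIntegral.integral_const_mul,
        integral_cos, Real.sin_two_pi, Real.sin_zero]
      ring
    rw [hparts, Real.sin_zero, Real.sin_two_pi, mul_zero, mul_zero, sub_zero, zero_sub] at hrD
    -- divide by r
    have key : lcRegD3 R₀ r = -(∫ t in (0 : ℝ)..(2 * π),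
        3 * r * R₀ * Real.sin t * (lcU R₀ r t ^ 2 * Real.sqrt (lcU R₀ r t))⁻¹ * Real.sin t) / r := by
      rw [eq_div_iff hpos.ne', mul_comm]; exact hrD
    rw [key, ← intervalIntegral.integral_const_mul, ← intervalIntegral.integral_neg, ← intervalIntegral.integral_div]
    refine intervalIntegral.integral_congr fun t _ => ?_
    field_simp

/-- **`D₅ = −5R₀∫₀^{π} sin²t·(u³√u)⁻¹ dt`** on every loop `0 ≤ r`, `2r < R₀` (axis included).
[cite: Jardin2010, §8.5.4 eq. (8.134)] -/
theorem lcRegD5_eq_sinSq :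
    lcRegD5 R₀ r = -5 * R₀ * ∫ t in (0 : ℝ)..π,
      Real.sin t ^ 2 * (lcU R₀ r t ^ 3 * Real.sqrt (lcU R₀ r t))⁻¹ := by
  have hu := lcU_pos hR₀ hr h2r
  have hcu : Continuous (fun t => lcU R₀ r t) := by unfold lcU; fun_prop
  have hne2 : ∀ t, lcU R₀ r t ^ 2 * Real.sqrt (lcU R₀ r t) ≠ 0 := fun t =>
    mul_ne_zero (pow_ne_zero 2 (hu t).ne') (Real.sqrt_pos.2 (hu t)).ne'
  have hne3 : ∀ t, lcU R₀ r t ^ 3 * Real.sqrt (lcU R₀ r t) ≠ 0 := fun t =>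
    mul_ne_zero (pow_ne_zero 3 (hu t).ne') (Real.sqrt_pos.2 (hu t)).ne'
  rcases hr.eq_or_lt with h0 | hpos
  · subst h0
    rw [(lcRegD35_axis hR₀).2]
    have e : ∀ t ∈ uIcc (0 : ℝ) π,
        Real.sin t ^ 2 * (lcU R₀ 0 t ^ 3 * Real.sqrt (lcU R₀ 0 t))⁻¹ = (R₀ ^ 7)⁻¹ * Real.sin t ^ 2 := by
      intro t _; rw [sqrt_lcU_axis hR₀, lcU_axis]; ring
    rw [intervalIntegral.integral_congr e, intervalIntegral.integral_const_mul, integral_sin_sq]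
    have hR := hR₀.ne'
    simp
    field_simp
  · have hU' : IntervalIntegrable (fun t => 5 * r * R₀ * Real.sin t * (lcU R₀ r t ^ 3 * Real.sqrt (lcU R₀ r t))⁻¹)
        volume 0 π := by
      refine Continuous.intervalIntegrable ?_ _ _
      refine ((continuous_const.mul Real.continuous_sin)).mul (((hcu.pow 3).mul hcu.sqrt).inv₀ ?_)
      intro t; exact mul_ne_zero (pow_ne_zero 3 (hu t).ne') (Real.sqrt_pos.2 (hu t)).ne'
    have hparts := intervalIntegral.integral_mul_deriv_eq_deriv_mul (a := 0) (b := π)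
      (u := fun t => (lcU R₀ r t ^ 2 * Real.sqrt (lcU R₀ r t))⁻¹) (v := Real.sin)
      (u' := fun t => 5 * r * R₀ * Real.sin t * (lcU R₀ r t ^ 3 * Real.sqrt (lcU R₀ r t))⁻¹) (v' := Real.cos)
      (fun t _ => hasDerivAt_inv_uSq_sqrt hR₀ hr h2r t) (fun t _ => Real.hasDerivAt_sin t) hU'
      (Real.continuous_cos.intervalIntegrable _ _)
    have hrD : r * lcRegD5 R₀ r = ∫ t in (0 : ℝ)..π, (lcU R₀ r t ^ 2 * Real.sqrt (lcU R₀ r t))⁻¹ * Real.cos t := by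
      unfold lcRegD5
      rw [← intervalIntegral.integral_const_mul]
      have e : ∀ t ∈ uIcc (0 : ℝ) π, r * (Real.cos t * lcDivDiff5 R₀ r t)
          = (lcU R₀ r t ^ 2 * Real.sqrt (lcU R₀ r t))⁻¹ * Real.cos t - (R₀ ^ 5)⁻¹ * Real.cos t := by
        intro t _
        have h := mul_lcDivDiff5 (r := r) (t := t) hR₀ (hu t)
        calc r * (Real.cos t * lcDivDiff5 R₀ r t) = Real.cos t * (r * lcDivDiff5 R₀ r t) := by ring
          _ = _ := by rw [h]; ring
      have hi1 : IntervalIntegrable (fun t => (lcU R₀ r t ^ 2 * Real.sqrt (lcU R₀ r t))⁻¹ * Real.cos t) volume 0 π := by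
        refine Continuous.intervalIntegrable ?_ _ _
        fun_prop (disch := assumption)
      have hi2 : IntervalIntegrable (fun t => (R₀ ^ 5)⁻¹ * Real.cos t) volume 0 π := by
        refine Continuous.intervalIntegrable ?_ _ _
        fun_prop
      rw [intervalIntegral.integral_congr e, intervalIntegral.integral_sub hi1 hi2, intervalIntegral.integral_const_mul,
        integral_cos, Real.sin_pi, Real.sin_zero]
      ring
    rw [hparts, Real.sin_zero, Real.sin_pi, mul_zero, mul_zero, sub_zero, zero_sub] at hrD
    have key : lcRegD5 R₀ r = -(∫ t in (0 : ℝ)..π,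
        5 * r * R₀ * Real.sin t * (lcU R₀ r t ^ 3 * Real.sqrt (lcU R₀ r t))⁻¹ * Real.sin t) / r := by
      rw [eq_div_iff hpos.ne', mul_comm]; exact hrD
    rw [key, ← intervalIntegral.integral_const_mul, ← intervalIntegral.integral_neg, ← intervalIntegral.integral_div]
    refine intervalIntegral.integral_congr fun t _ => ?_
    field_simp

end ibp

end LcMercierRegular

end Summit.Ventures.FusionMHD.Models

end
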